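import Literature.NumberTheory.Irrationality.Fischler2002.RhinViolaGroup32CardProofs
import Literature.NumberTheory.Irrationality.Fischler2002.JnChiProofs
import Literature.NumberTheory.Irrationality.Fischler2002.JnPsiProofs
import Literature.NumberTheory.Irrationality.Fischler2002.JnFinitenessCriterionProofs
import HarnessLib

/-!
# Fischler 2002, Proposition 3.1 — the group `⟨σ, ψ, χ⟩`, III: the Rhin–Viola property; `prop31_holds`

Topic `Literature/NumberTheory/Irrationality/Fischler2002`. PROOFS ONLY (no definition, no statement). This file
DISCHARGES the named fact `prop31` of `RhinViolaGroupsGeneral.lean`: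

> [Fischler2002Polyzetas, §3 Proposition 3.1] « Si `n ≥ 3`, la famille `(𝒥(p))` admet un groupe de Rhin-Viola
> d'ordre 32, isomorphe à `(D₂ × D₂) ⋊ ℤ/2ℤ`, qui est engendré par `σ`, `ψ` et `χ`. »
> (= [Fischler2003RhinViola, §4.3 Théorème 8 p. 524]; read on the page, `paper:arxiv-math_0202064` p. 4.)

as typed: for `n ≥ 3` there are permutations `σ', ψ', χ'` of `Exponents` with underlying maps `sigma`, `psi n`,
`chi n` (they are involutions: `sigma_sigma`, `Prop31.psi_psi`, `chi_chi`), the subgroup they generate has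
`Nat.card = 32` (`Prop31.card_closure_eq`, part II), and it is a Rhin–Viola group for `𝒥` in the typed sense
`IsRhinViolaGroup` — whenever `𝒥(p)` and `𝒥(gp)` are both finite their ratio is rational:

* `Prop31.chi_step` — one `χ`-step: `𝒥(y), 𝒥(χy) < ∞` ⇒ `𝒥(χy) = q·𝒥(y)`, `q = c_n!(a_n+b_n−c_n)!/(a_n!b_n!) ∈ ℚ_{>0}`
  (finiteness of both sides gives Fischler's criterion for `y` and `χy` by ct-1's `Jn_finite_iff_holds`, whence the
  four non-negativities under which ct-1's `Jn_chi_holds` is Euler's exchange);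
* `Prop31.chi_ne_top_of_chi_psi_chi` — the only delicate point: along the word `χψχ` the intermediate value `𝒥(χq)`
  is finite as soon as the two ends are (`χ' = ψχψ` fixes the `n`-th coordinates — closed form of part I — so the
  criterion for `χ'χq` yields `c_n, a_n+b_n−c_n ≥ 0` for `q`, and `𝒥(q) = r·𝒥(χq)`, `r > 0`, transfers finiteness);
* `Prop31.isRhinViolaGroup_closure` — every `g ∈ ⟨σ, ψ, χ⟩` is a word `ψ^e σ^α χ'^β χ^γ σ'^δ` (part II); `σ, ψ`
  preserve `𝒥` exactly (`Jn_sigma_holds`, ct-1's `Jn_psi_holds`), leaving at most two `χ`-steps;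
* `prop31_holds : prop31` (binder-free, in the fact's namespace).

HONEST FRAMING (cell pub-zeta5): systematic search; no irrationality claim unless certified — Fischler's order-32
Rhin–Viola group in every dimension `n ≥ 3` is now a theorem of the tree; an identity-and-bookkeeping statement about
(possibly infinite) integrals of non-negative functions; nothing about `ζ(5)`.
-/

namespace Literature.NumberTheory.Irrationality.Fischler2002

namespace Prop31

/-! ### The Rhin–Viola property of `⟨σ, ψ, χ⟩` for the family `𝒥` -/

section RhinViola

open scoped ENNReal

variable {n : ℕ} {gσ gψ gχ : Equiv.Perm Exponents}
  {W : Bool → Bool → Bool → Bool → Bool → Equiv.Perm Exponents}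

/-- **One `χ`-step.** If `𝒥(y)` and `𝒥(χy)` are both finite then `𝒥(χy)/𝒥(y)` is a positive rational
(`= c_n!(a_n+b_n−c_n)!/(a_n!b_n!)`): finiteness of both sides gives the finiteness criterion for `y` and for `χy`
(`Jn_finite_iff_holds`), whence `a_n, b_n, c_n, a_n+b_n−c_n ≥ 0`, and `Jn_chi_holds` applies.
[cite: Fischler2002Polyzetas, §3 p. 3 (formule pour χ) and Proposition 3.1] -/
theorem chi_step (hn : 2 ≤ n) (y : Exponents) (hy : Jn n y ≠ ∞) (hχy : Jn n (chi n y) ≠ ∞) :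
    ∃ q : ℚ, 0 < q ∧ Jn n (chi n y) = ENNReal.ofReal q * Jn n y := by
  have hcy : FinitenessCriterionGen n y := (Jn_finite_iff_holds n y hn).1 hy
  obtain ⟨haχ, hbχ, -⟩ := (Jn_finite_iff_holds n (chi n y) hn).1 hχy
  have hmem : n ∈ Finset.Icc 1 n := Finset.mem_Icc.2 ⟨by omega, le_rfl⟩
  have hc : 0 ≤ y.c n := by simpa [chi] using haχ n hmem
  have habc : 0 ≤ y.a n + y.b n - y.c n := by simpa [chi] using hbχ n hmem
  have hE := Jn_chi_holds n y hn hcy hc habc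
  set N₁ : ℕ := (y.a n).toNat.factorial * (y.b n).toNat.factorial with hN₁
  set N₂ : ℕ := (y.c n).toNat.factorial * (y.a n + y.b n - y.c n).toNat.factorial with hN₂
  have hN₁pos : (0 : ℝ) < N₁ := by rw [hN₁]; positivity
  have hN₂pos : (0 : ℝ) < N₂ := by rw [hN₂]; positivity
  refine ⟨(N₂ : ℚ) / N₁, by positivity, ?_⟩
  have hcast : (((N₂ : ℚ) / N₁ : ℚ) : ℝ) = (N₂ : ℝ) / N₁ := by push_cast; rfl
  rw [hcast, hE, ← mul_assoc, ← ENNReal.ofReal_mul (by positivity),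
    show (N₂ : ℝ) / N₁ * ((N₁ : ℝ) / N₂) = 1 by field_simp, ENNReal.ofReal_one, one_mul]

/-- **Two `χ`-steps with a `ψ` between.** If `𝒥(q)` and `𝒥(χψχq)` are finite then so is `𝒥(χq)` (`n ≥ 3`):
`𝒥(ψ·χψχq) = 𝒥(χψχq)` is finite, so `χ'χq` (`χ' = ψχψ`, which fixes the `n`-th coordinates) satisfies the
criterion, giving `c_n(q) ≥ 0`, `a_n(q)+b_n(q)−c_n(q) ≥ 0`; then `𝒥(q) = r·𝒥(χq)` with `r > 0` (`Jn_chi_holds`) and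
`𝒥(q) < ∞` force `𝒥(χq) < ∞`. [cite: Fischler2002Polyzetas, §3 Proposition 3.1] -/
theorem chi_ne_top_of_chi_psi_chi (hn : 3 ≤ n) (q : Exponents) (hq : Jn n q ≠ ∞)
    (h2 : Jn n (chi n (psi n (chi n q))) ≠ ∞) : Jn n (chi n q) ≠ ∞ := by
  have hcq : FinitenessCriterionGen n q := (Jn_finite_iff_holds n q (by omega)).1 hq
  have h3 : Jn n (psi n (chi n (psi n (chi n q)))) ≠ ∞ := by
    rwa [Jn_psi_holds n _ (by omega)]
  obtain ⟨ha3, hb3, -⟩ := (Jn_finite_iff_holds n _ (by omega)).1 h3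
  have hmem : n ∈ Finset.Icc 1 n := Finset.mem_Icc.2 ⟨by omega, le_rfl⟩
  have hn1 : n ≠ 1 := by omega
  have hn2 : n ≠ 2 := by omega
  have hc : 0 ≤ q.c n := by
    have := ha3 n hmem
    rw [psi_chi_psi_eq hn] at this
    simpa [chi, hn1] using this
  have habc : 0 ≤ q.a n + q.b n - q.c n := by
    have := hb3 n hmem
    rw [psi_chi_psi_eq hn] at this
    simpa [chi, hn2] using this
  have hE := Jn_chi_holds n q (by omega) hcq hc habc
  have hpos : (0 : ℝ) < (((q.a n).toNat.factorial * (q.b n).toNat.factorial : ℕ) : ℝ) /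
      (((q.c n).toNat.factorial * (q.a n + q.b n - q.c n).toNat.factorial : ℕ) : ℝ) := by positivity
  intro htop
  rw [htop, ENNReal.mul_top (by simpa using hpos)] at hE
  exact hq hE

/-- **The Rhin–Viola property.** For every `g ∈ ⟨σ, ψ, χ⟩` and every `p` with `𝒥(p), 𝒥(gp)` finite,
`𝒥(gp) = q·𝒥(p)` for a (positive) rational `q`: write `g = ψ^e σ^α χ'^β χ^γ σ'^δ`; `σ, ψ` (hence `σ'`) preserve `𝒥`
exactly (`Jn_sigma_holds`, `Jn_psi_holds`), so only the at most two `χ`-steps matter (`chi_step`,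
`chi_ne_top_of_chi_psi_chi`). [cite: Fischler2002Polyzetas, §3 Proposition 3.1] [cite: Fischler2003RhinViola, §4.3 Théorème 8 p. 524] -/
theorem isRhinViolaGroup_closure (hn : 3 ≤ n) (hσ : ⇑gσ = sigma) (hψ : ⇑gψ = psi n) (hχ : ⇑gχ = chi n) :
    IsRhinViolaGroup (Jn n) (Subgroup.closure ({gσ, gψ, gχ} : Set (Equiv.Perm Exponents))) := by
  obtain ⟨W, hW⟩ : ∃ W : Bool → Bool → Bool → Bool → Bool → Equiv.Perm Exponents, ∀ e α β γ δ,
      W e α β γ δ = (bif e then gψ else 1) * (bif α then gσ else 1) *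
        (bif β then gψ * gχ * gψ else 1) * (bif γ then gχ else 1) * (bif δ then gψ * gσ * gψ else 1) :=
    ⟨_, fun _ _ _ _ _ => rfl⟩
  have hn2 : 2 ≤ n := by omega
  have Jσ : ∀ x, Jn n (gσ x) = Jn n x := fun x => by rw [hσ]; exact Jn_sigma_holds n x hn2
  have Jψ : ∀ x, Jn n (gψ x) = Jn n x := fun x => by rw [hψ]; exact Jn_psi_holds n x hn2
  have Jcond : ∀ (b : Bool) (g : Equiv.Perm Exponents), (∀ x, Jn n (g x) = Jn n x) →
      ∀ x, Jn n ((bif b then g else 1) x) = Jn n x := by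
    intro b g hg x
    cases b
    · rfl
    · exact hg x
  have Jσ' : ∀ x, Jn n ((gψ * gσ * gψ) x) = Jn n x := fun x => by
    simp only [Equiv.Perm.mul_apply, Jψ, Jσ]
  intro g hg p hp hgp
  obtain ⟨e, α, β, γ, δ, rfl⟩ := exists_word_of_mem_closure hn hσ hψ hχ hW hg
  -- the point after `σ'^δ`
  set q := (bif δ then gψ * gσ * gψ else 1) p with hqdef
  have hJq : Jn n q = Jn n p := Jcond δ _ Jσ' p
  have hq : Jn n q ≠ ∞ := by rwa [hJq]
  -- strip `ψ^e σ^α`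
  have hstrip : Jn n (W e α β γ δ p) =
      Jn n ((bif β then gψ * gχ * gψ else 1) ((bif γ then gχ else 1) q)) := by
    rw [hW]
    simp only [Equiv.Perm.mul_apply]
    rw [Jcond e _ Jψ, Jcond α _ Jσ]
  rw [hstrip] at hgp ⊢
  cases β <;> cases γ <;> simp only [cond_true, cond_false, Equiv.Perm.one_apply, Equiv.Perm.mul_apply] at hgp ⊢
  · -- β = false, γ = false
    exact ⟨1, by simp [hJq]⟩
  · -- β = false, γ = true : one χ-step at q
    rw [hχ] at hgp ⊢
    obtain ⟨r, -, hr⟩ := chi_step hn2 q hq hgp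
    exact ⟨r, by rw [hr, hJq]⟩
  · -- β = true, γ = false : one χ-step at ψq
    rw [Jψ, hχ, hψ] at hgp ⊢
    have hy : Jn n (psi n q) ≠ ∞ := by rwa [Jn_psi_holds n q hn2]
    obtain ⟨r, -, hr⟩ := chi_step hn2 (psi n q) hy hgp
    exact ⟨r, by rw [hr, Jn_psi_holds n q hn2, hJq]⟩
  · -- β = true, γ = true : two χ-steps
    rw [Jψ, hχ, hψ] at hgp ⊢
    have h1 : Jn n (chi n q) ≠ ∞ := chi_ne_top_of_chi_psi_chi hn q hq hgp
    obtain ⟨r₁, -, hr₁⟩ := chi_step hn2 q hq h1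
    have hy : Jn n (psi n (chi n q)) ≠ ∞ := by rwa [Jn_psi_holds n _ hn2]
    obtain ⟨r₂, hr₂pos, hr₂⟩ := chi_step hn2 (psi n (chi n q)) hy hgp
    refine ⟨r₂ * r₁, ?_⟩
    rw [hr₂, Jn_psi_holds n _ hn2, hr₁, hJq, ← mul_assoc, Rat.cast_mul,
      ENNReal.ofReal_mul (by exact_mod_cast hr₂pos.le)]

end RhinViola

end Prop31

/-- **Fischler 2002, Proposition 3.1 holds** (the named fact `prop31` of `RhinViolaGroupsGeneral.lean` is a theorem):
for every `n ≥ 3`, the maps `σ`, `ψ`, `χ` are permutations of `ℤ^{3n−1}` (involutions), the group they generate has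
order `32` (`Prop31.card_closure_eq`: it is `{ψ^e σ^α χ'^β χ^γ σ'^δ}`, the printed `(D₂ × D₂) ⋊ ℤ/2ℤ`), and it is a
Rhin–Viola group for `(𝒥(p))_p` (`Prop31.isRhinViolaGroup_closure`, from `Jn_sigma_holds`, `Jn_psi_holds`,
`Jn_chi_holds`, `Jn_finite_iff_holds`). [cite: Fischler2002Polyzetas, §3 Proposition 3.1]
[cite: Fischler2003RhinViola, §4.3 Théorème 8 p. 524] -/
theorem prop31_holds : prop31 := by
  intro n hn
  exact ⟨Function.Involutive.toPerm sigma sigma_sigma, Function.Involutive.toPerm (psi n) (Prop31.psi_psi (by omega)),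
    Function.Involutive.toPerm (chi n) (chi_chi n), rfl, rfl, rfl, Prop31.card_closure_eq hn rfl rfl rfl,
    Prop31.isRhinViolaGroup_closure hn rfl rfl rfl⟩


end Literature.NumberTheory.Irrationality.Fischler2002
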